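import Literature.Geometry.Manifold.OpenEmbeddingCriterion
import Mathlib.Geometry.Manifold.Algebra.SMul
import Mathlib.Geometry.Manifold.Algebra.Structures
import Mathlib.Analysis.InnerProductSpace.Calculus
import Mathlib.Analysis.Complex.Basic
import HarnessLib

/-!
# From a unit framing to the fibre multiplier of a surface tube (radial extension)

Topic `Literature/Topology/FourManifolds` (fact seat of the Seiberg–Witten leaf
`Literature.Barriers.SmoothPoincare4.akhmedovPark2010_lemma8_invariants`; block 2 of
Akhmedov–Park's `X₁(m)`, A. Akhmedov, B. D. Park, Invent. Math. 181 (2010), §3).  In the assembly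
of the tube of `Σ̄₂ ⊂ T⁴ # ℂℙ²bar` each sheet's product tube `T (p, v)` is used with a fibre
multiplier `Ψ p ∈ ℂ` (`v ↦ Ψ p · ṽ`), which near the RESOLVED plumbing point `xα` must be
`ϱ₀ · conj (α p/‖α p‖)` (so that the resolution neck of `DoublePointResolutionNeck.lean` continues
it) and near the BLOWN-UP plumbing point `xγ` must be `κ · γ p` (so that the blow-up cap of
`BlowUpLineCapTube.lean` continues it; `α`, `γ` the complex surface coordinates at the two
points).  `FramingPhaseCorrection.lean` produces a UNIT framing `φ` on the complement of the two
points with the right phases (`conj α̂` near `xα`, `γ̂` near `xγ`); this file performs the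
remaining elementary step, **the radial extension**: from such a `φ`, a smooth bump `χ`
localised at `xγ` and the closedness of a coordinate disc, it produces `Ψ` smooth off `xα`,
non-vanishing off `{xα, xγ}`, equal to `ϱ₀ conj α̂` on the punctured `α`-disc and to `κ γ` on a
`γ`-disc (`exists_fibreMultiplier`: `Ψ = κ γ` on the small `γ`-disc and
`Ψ = (ϱ₀ + χ (κ ‖γ‖ - ϱ₀)) • φ` elsewhere, the two agreeing where `χ = 1`).
Everything is proved; no definitions.

## References

* A. Akhmedov, B. D. Park, Invent. Math. 181 (2010) 577–603 = arXiv:math/0701829, §3. [AkhmedovPark2010]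
-/

noncomputable section

open scoped Manifold ContDiff Topology ComplexConjugate
open Set Function Complex

namespace Literature.Topology.FourManifolds

namespace FibreMultiplier

variable {E : Type*} [NormedAddCommGroup E] [NormedSpace ℝ E] {H : Type*} [TopologicalSpace H]
  {I : ModelWithCorners ℝ E H} {M : Type*} [TopologicalSpace M] [T2Space M] [ChartedSpace H M]

/-- **Radial extension of a unit framing to a fibre multiplier.**  See the module docstring.
Hypotheses: `γ` smooth on the open `Uγ ∋ xγ`, vanishing there exactly at `xγ`; the closed
coordinate disc `{‖γ‖ ≤ R₁}` (closed in `M`); a smooth bump `0 ≤ χ ≤ 1`, `χ = 1` on `{‖γ‖ ≤ R₂}`,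
supported in `{‖γ‖ < R₃}` (`R₁ < R₂ < R₃`); the unit framing `φ`, smooth on `M ∖ {xα, xγ}`, equal to
`conj α̂` on the punctured `α`-disc `{0 < ‖α‖ < Rα} ⊆ Uα` and to `γ̂` on the punctured `γ`-disc
`{0 < ‖γ‖ < R₃}`; the `α`-disc misses the `γ`-disc.  Conclusion: a multiplier `Ψ` smooth on
`M ∖ {xα}`, non-zero on `M ∖ {xα, xγ}`, `Ψ = ϱ₀ conj α̂` on the punctured `α`-disc and `Ψ = κ γ` on
`{‖γ‖ < R₂}`. [cite: AkhmedovPark2010, §3] -/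
theorem exists_fibreMultiplier {xα xγ : M} {Uα Uγ : Set M} (hUγ : IsOpen Uγ)
    {α γ : M → ℂ} (hγ : ContMDiffOn I 𝓘(ℝ, ℂ) ∞ γ Uγ)
    (hγ0 : ∀ p ∈ Uγ, γ p = 0 ↔ p = xγ) (hxγ : xγ ∈ Uγ)
    {Rα R₁ R₂ R₃ ϱ₀ κ : ℝ} (hR₁ : 0 < R₁) (hR₁₂ : R₁ < R₂) (hR₂₃ : R₂ < R₃) (hϱ₀ : 0 < ϱ₀) (hκ : 0 < κ)
    (hK : IsClosed {p | p ∈ Uγ ∧ ‖γ p‖ ≤ R₁})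
    {χ : M → ℝ} (hχ : ContMDiff I 𝓘(ℝ, ℝ) ∞ χ) (hχ01 : ∀ p, 0 ≤ χ p ∧ χ p ≤ 1)
    (hχ1 : ∀ p ∈ Uγ, ‖γ p‖ ≤ R₂ → χ p = 1)
    (hχs : tsupport χ ⊆ {p | p ∈ Uγ ∧ ‖γ p‖ < R₃})
    {φ : M → ℂ} (hφ : ContMDiffOn I 𝓘(ℝ, ℂ) ∞ φ {p | p ≠ xα ∧ p ≠ xγ})
    (hφ1 : ∀ p, p ≠ xα → p ≠ xγ → ‖φ p‖ = 1)
    (hφα : ∀ p ∈ Uα, 0 < ‖α p‖ → ‖α p‖ < Rα → φ p = conj (((‖α p‖⁻¹ : ℝ) : ℂ) * α p))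
    (hφγ : ∀ p ∈ Uγ, 0 < ‖γ p‖ → ‖γ p‖ < R₃ → φ p = ((‖γ p‖⁻¹ : ℝ) : ℂ) * γ p)
    (hdisj : ∀ p ∈ Uα, ‖α p‖ < Rα → p ∉ {q | q ∈ Uγ ∧ ‖γ q‖ < R₃}) :
    ∃ Ψ : M → ℂ,
      ContMDiffOn I 𝓘(ℝ, ℂ) ∞ Ψ {p | p ≠ xα} ∧
      (∀ p, p ≠ xα → p ≠ xγ → Ψ p ≠ 0) ∧
      (∀ p ∈ Uα, 0 < ‖α p‖ → ‖α p‖ < Rα → Ψ p = ((ϱ₀ : ℝ) : ℂ) * conj (((‖α p‖⁻¹ : ℝ) : ℂ) * α p)) ∧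
      (∀ p ∈ Uγ, ‖γ p‖ < R₂ → Ψ p = ((κ : ℝ) : ℂ) * γ p) := by
  classical
  -- the two open pieces
  set O₁ : Set M := {p | p ∈ Uγ ∧ ‖γ p‖ < R₂} with hO₁
  set O₂ : Set M := {p | p ∈ Uγ ∧ ‖γ p‖ ≤ R₁}ᶜ with hO₂
  have hγc : ContinuousOn γ Uγ := hγ.continuousOn
  have hO₁o : IsOpen O₁ := by
    have : O₁ = Uγ ∩ γ ⁻¹' Metric.ball 0 R₂ := by
      ext p; simp [hO₁, Metric.mem_ball, dist_zero_right]
    rw [this]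
    exact hγc.isOpen_inter_preimage hUγ Metric.isOpen_ball
  have hO₂o : IsOpen O₂ := hK.isOpen_compl
  have hcover : ∀ p, p ∈ O₁ ∨ p ∈ O₂ := fun p => by
    by_cases h : p ∈ Uγ ∧ ‖γ p‖ ≤ R₁
    · exact Or.inl ⟨h.1, lt_of_le_of_lt h.2 hR₁₂⟩
    · exact Or.inr h
  have hxγO₂ : xγ ∉ O₂ := fun h => h ⟨hxγ, by rw [(hγ0 xγ hxγ).2 rfl, norm_zero]; exact hR₁.le⟩
  -- the radial factor `ϱ = ϱ₀ + χ (κ ‖γ‖ - ϱ₀)` and the two formulas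
  let ϱ : M → ℝ := fun p => ϱ₀ + χ p * (κ * ‖γ p‖ - ϱ₀)
  let Ψ₂ : M → ℂ := fun p => (ϱ p : ℝ) • φ p
  let Ψ₁ : M → ℂ := fun p => (κ : ℝ) • γ p
  let Ψ : M → ℂ := O₁.piecewise Ψ₁ Ψ₂
  -- agreement on the overlap, hence `Ψ = Ψ₂` on `O₂`
  have hagree : ∀ p ∈ O₁ ∩ O₂, Ψ₁ p = Ψ₂ p := by
    rintro p ⟨⟨hpU, hp2⟩, hpO₂⟩
    have hp0 : 0 < ‖γ p‖ := by
      rw [norm_pos_iff]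
      intro h0
      exact hxγO₂ (((hγ0 p hpU).1 h0) ▸ hpO₂)
    have hχp : χ p = 1 := hχ1 p hpU hp2.le
    show (κ : ℝ) • γ p = (ϱ p : ℝ) • φ p
    have hϱp : ϱ p = κ * ‖γ p‖ := by show ϱ₀ + χ p * (κ * ‖γ p‖ - ϱ₀) = _; rw [hχp]; ring
    rw [hϱp, hφγ p hpU hp0 (lt_trans hp2 hR₂₃), Complex.real_smul, Complex.real_smul, ← mul_assoc,
      ← Complex.ofReal_mul, mul_assoc κ, mul_inv_cancel₀ hp0.ne', mul_one]
  have hΨ₁ : ∀ p ∈ O₁, Ψ p = Ψ₁ p := fun p hp => piecewise_eq_of_mem _ _ _ hp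
  have hΨ₂ : ∀ p ∈ O₂, Ψ p = Ψ₂ p := fun p hp => by
    by_cases h : p ∈ O₁
    · rw [hΨ₁ p h, hagree p ⟨h, hp⟩]
    · exact piecewise_eq_of_notMem _ _ _ h
  -- smoothness of `ϱ` on `O₂`
  have hϱ : ContMDiffOn I 𝓘(ℝ, ℝ) ∞ ϱ O₂ := by
    intro p hp
    by_cases hps : p ∈ tsupport χ
    · -- near `p` we are inside `Uγ ∖ {xγ}`, where `‖γ‖` is smooth
      obtain ⟨hpU, -⟩ := hχs hps
      have hp0 : γ p ≠ 0 := fun h0 => hxγO₂ (((hγ0 p hpU).1 h0) ▸ hp)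
      have hn : ContMDiffWithinAt I 𝓘(ℝ, ℝ) ∞ (fun q => ‖γ q‖) O₂ p := by
        have h1 : ContMDiffAt I 𝓘(ℝ, ℂ) ∞ γ p := (hγ p hpU).contMDiffAt (hUγ.mem_nhds hpU)
        have h2 : ContDiffAt ℝ ∞ (fun z : ℂ => ‖z‖) (γ p) := contDiffAt_norm ℝ hp0
        exact (h2.comp_contMDiffAt h1).contMDiffWithinAt
      exact contMDiffWithinAt_const.add ((hχ p).contMDiffWithinAt.mul
        ((contMDiffWithinAt_const.mul hn).sub contMDiffWithinAt_const))
    · -- near `p`, `χ = 0` and `ϱ = ϱ₀`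
      have hev : ϱ =ᶠ[𝓝 p] fun _ => ϱ₀ := by
        have : ∀ᶠ q in 𝓝 p, χ q = 0 := by
          have hopen : IsOpen (tsupport χ)ᶜ := (isClosed_tsupport χ).isOpen_compl
          exact Filter.eventually_of_mem (hopen.mem_nhds hps) fun q hq => image_eq_zero_of_notMem_tsupport hq
        filter_upwards [this] with q hq
        show ϱ₀ + χ q * (κ * ‖γ q‖ - ϱ₀) = ϱ₀
        rw [hq, zero_mul, add_zero]
      exact (contMDiffAt_const.congr_of_eventuallyEq hev).contMDiffWithinAt
  have hϱpos : ∀ p ∈ O₂, 0 < ϱ p := by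
    intro p hp
    obtain ⟨h0, h1⟩ := hχ01 p
    show 0 < ϱ₀ + χ p * (κ * ‖γ p‖ - ϱ₀)
    by_cases hχ0 : χ p = 0
    · rw [hχ0, zero_mul, add_zero]; exact hϱ₀
    · have hps : p ∈ tsupport χ := subset_tsupport χ (Function.mem_support.2 hχ0)
      obtain ⟨hpU, -⟩ := hχs hps
      have hp0 : 0 < ‖γ p‖ := norm_pos_iff.2 fun h => hxγO₂ (((hγ0 p hpU).1 h) ▸ hp)
      have : ϱ₀ + χ p * (κ * ‖γ p‖ - ϱ₀) = (1 - χ p) * ϱ₀ + χ p * (κ * ‖γ p‖) := by ring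
      rw [this]
      have hκγ : 0 < κ * ‖γ p‖ := mul_pos hκ hp0
      rcases lt_or_eq_of_le h1 with hlt | heq
      · nlinarith [mul_nonneg h0 hκγ.le]
      · rw [heq]; linarith
  refine ⟨Ψ, ?_, ?_, ?_, ?_⟩
  · -- smoothness off `xα`
    intro p hp
    rcases hcover p with h1 | h2
    · have hev : Ψ =ᶠ[𝓝 p] Ψ₁ := Filter.eventually_of_mem (hO₁o.mem_nhds h1) hΨ₁
      have hκc : ContMDiffAt I 𝓘(ℝ, ℝ) ∞ (fun _ : M => κ) p := contMDiffAt_const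
      have h : ContMDiffAt I 𝓘(ℝ, ℂ) ∞ Ψ₁ p :=
        ContMDiffAt.smul hκc ((hγ p h1.1).contMDiffAt (hUγ.mem_nhds h1.1))
      exact (h.congr_of_eventuallyEq hev).contMDiffWithinAt
    · have hev : Ψ =ᶠ[𝓝 p] Ψ₂ := Filter.eventually_of_mem (hO₂o.mem_nhds h2) hΨ₂
      have hpγ : p ≠ xγ := fun h => hxγO₂ (h ▸ h2)
      have hφp : ContMDiffAt I 𝓘(ℝ, ℂ) ∞ φ p := by
        refine (hφ p ⟨hp, hpγ⟩).contMDiffAt ?_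
        have : IsOpen {q : M | q ≠ xα ∧ q ≠ xγ} := by
          simp only [Set.setOf_and]
          exact isOpen_ne.inter isOpen_ne
        exact this.mem_nhds ⟨hp, hpγ⟩
      have hϱp : ContMDiffAt I 𝓘(ℝ, ℝ) ∞ ϱ p := (hϱ p h2).contMDiffAt (hO₂o.mem_nhds h2)
      exact ((ContMDiffAt.smul hϱp hφp).congr_of_eventuallyEq hev).contMDiffWithinAt
  · -- non-vanishing off `{xα, xγ}`
    intro p hpα hpγ
    rcases hcover p with h1 | h2
    · rw [hΨ₁ p h1]
      show (κ : ℝ) • γ p ≠ 0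
      have : γ p ≠ 0 := fun h => hpγ ((hγ0 p h1.1).1 h)
      exact smul_ne_zero hκ.ne' this
    · rw [hΨ₂ p h2]
      show (ϱ p : ℝ) • φ p ≠ 0
      have : φ p ≠ 0 := by rw [← norm_ne_zero_iff, hφ1 p hpα hpγ]; exact one_ne_zero
      exact smul_ne_zero (hϱpos p h2).ne' this
  · -- the form near `xα`
    intro p hpU hp0 hpR
    have hnot := hdisj p hpU hpR
    have h2 : p ∈ O₂ := fun h => hnot ⟨h.1, lt_of_le_of_lt h.2 (lt_trans hR₁₂ hR₂₃)⟩
    have hχp : χ p = 0 := by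
      by_contra h
      exact hnot (hχs (subset_tsupport χ (Function.mem_support.2 h)))
    rw [hΨ₂ p h2]
    show (ϱ p : ℝ) • φ p = _
    have : ϱ p = ϱ₀ := by show ϱ₀ + χ p * (κ * ‖γ p‖ - ϱ₀) = ϱ₀; rw [hχp, zero_mul, add_zero]
    rw [this, hφα p hpU hp0 hpR, Complex.real_smul]
  · -- the form near `xγ`
    intro p hpU hpR
    rw [hΨ₁ p ⟨hpU, hpR⟩]
    show (κ : ℝ) • γ p = _
    rw [Complex.real_smul]

end FibreMultiplier

end Literature.Topology.FourManifolds
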